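import Summits.FinalStateConjecture.FinalStateConjecture.Theorems.ZeroEnergyKerrOrBombErgoregionBombModTEscapeEngine
import Summits.FinalStateConjecture.FinalStateConjecture.Theorems.ZeroEnergyKerrOrBombErgoregionBombModTCertificateTransport
import Summits.FinalStateConjecture.FinalStateConjecture.Theorems.ZeroEnergyKerrOrBombErgoregionBombModTCertificateCompactness
import Summits.FinalStateConjecture.FinalStateConjecture.Theorems.ZeroEnergyKerrOrBombErgoregionBombModTCertificateNoLightPoint

/-!
# The zero-energy escape KERNEL from a Killing time and a pointwise escape function
# (crux stmt-FinalStateConjecture-17838 `ErgoregionBombModT`, line `SketchIdeator4`, kernel assembly of skeleton v3)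

Route `ZeroEnergyKerrOrBomb` of the Final State Conjecture, crux `ErgoregionBombModT` (the ergoregion bomb modulo the
stationary flow), line `SketchIdeator4` (zero-energy escape; crux workfiles `Cruxes/ErgoregionBombModT/Ideas/zero-energy-escape.md`,
`Cruxes/ErgoregionBombModT/Lines/SketchIdeator4.lean`).  The line closes the crux by VACUITY of its antecedent: the landed ENGINE
(`stub_escapeEngine`, `ergoregionBombModT_of_zeroEnergyEscapeCertificate`, p156340) shows that a *zero-energy escape
certificate* `(W, F, τ, c, C)` on the cage `⋃ₜ φₜ(S)` of a compact `S` forbids maximal zero-energy null geodesics confined to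
the cage, so the crux follows from the KERNEL "every cage of every telescope hole carries a certificate".  This file
ASSEMBLES the kernel from its parts of different status (skeleton v3 of the line):

* (X)   a Killing time with spacelike level sets on the d.o.c. — the PUBLISHED structure theorem of Chruściel–Costa
  (Astérisque 321 (2008), Thm. 4.5: `⟨⟨M_ext⟩⟩ ≈ ℝ × 𝒮₀`, `𝒮₀ = t⁻¹(0)` smooth and spacelike, the flow a translation of
  the `ℝ` factor), taken as a HYPOTHESIS `hX` spelled out in the tree's vocabulary (a smooth `t` on `⟨⟨M_ext⟩⟩` with
  `t (γ s) = t (γ 0) + s` along the flow and `dt_x(k) ≠ 0` for causal `k ≠ 0` over `⟨⟨M_ext⟩⟩`; proposed separately as the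
  Literature named fact `chruscielCosta2008_spacelikeTimeFunction` next to `chruscielCosta2008_equivariantTimeFunction`,
  which — like `chruscielCosta2008_docProductStructure` — records Thm. 4.5 WITHOUT the spacelike clause); the results
  below are CONDITIONAL on it;
* (U1)  transport of `g`, `g(·, T)`, `dτ`, `Hess F`, `Hess τ` along the cage by the flow isometries — landed
  `stub_certificateTransport` (p159576);
* (U2)  uniform constants over the compact `S` from pointwise strict convexity — landed `stub_certificateCompactness`
  (p159698);
* (ZF₀) the POINTWISE zero-energy escape function: for every compact `S ⊆ ⟨⟨M_ext⟩⟩` an open `W ⊇ ⋃ₜ φₜ(S)` and a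
  flow-invariant `F ∈ C²(W)` with `Hess F_x(k, k) > 0` for `x ∈ S` and every non-zero null `k ⊥ T` — the certificate half
  of the Alexakis–Ionescu–Klainerman picture, certified on Kerr by Carter's turning-point sign
  (`Kerr.hessAt_radius_neg_of_ksEnergy_eq_zero`), OPEN in general, taken as a HYPOTHESIS (the registered open stub
  `stub_zeroEnergyNullConvexFunction` of the line, verbatim).

Results:
* `zeroEnergyEscapeCertificate_of_nullConvex` — **KERNEL ⇐ X ∧ ZF₀** (hypothesis of p156340 verbatim as conclusion);
* `ergoregionBombModT_of_nullConvex` — **crux ⇐ X ∧ ZF₀** (body of `Theses.ZeroEnergyKerrOrBomb.ErgoregionBombModT` verbatim,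
  so that the type δ-unfolds to the route decl and the file stays free of the `Theses` import);
* `noDocLightPoints_of_nullConvex` — **NoDocLightPoints ⇐ ZF₀** (no Killing time needed): at a Killing light point
  `p ∈ ⟨⟨M_ext⟩⟩` (`g(T,T)(p) = 0`, `∇_T T = κ T`) the vector `T(p)` is itself a non-zero zero-energy null vector, and
  every `T`-invariant `C²` function has `Hess F(T, T)(p) = 0` (`hessian_killing_killing_eq_zero_of_lightPoint`, p142290),
  against `Hess F(T, T) > 0`; conclusion = hypothesis `hNo` of `ergoregionBombModT_of_offWall_of_noDocLightPoints`
  (p135563) verbatim.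

References: P. T. Chruściel, J. L. Costa, Astérisque 321 (2008) 195–265, arXiv:0806.0016, §4.2, Thm. 4.5;
B. O'Neill, *Semi-Riemannian geometry* (1983), Ch. 3, Lemma 3.49, Prop. 3.59, Ch. 9, Prop. 9.23; A. D. Ionescu,
S. Klainerman, Surveys Diff. Geom. 20 (2015) §4; G. P. Paternain, M. Salo, G. Uhlmann, *Geometric inverse problems*
(2023), Prop. 3.3.1 (non-trapping ⇔ escape function, the Riemannian prototype).
-/

noncomputable section

open Bundle Set Filter Function
open scoped Manifold Topology

set_option linter.dupNamespace false

namespace Summit.FinalStateConjecture.FinalStateConjecture.Theorems.ErgoregionBombModT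

open Literature.Geometry.Lorentzian

/-! ### Kernel assembly -/

/-- The `T`-orbit of a subset of `⟨⟨M_ext⟩⟩` stays in `⟨⟨M_ext⟩⟩` (flow-invariance of the d.o.c.,
`StationaryAFBlackHole.mem_doc_of_isMIntegralCurve`; Chruściel–Costa 2008, §2.2). -/
private theorem stationaryOrbit_subset_doc' (𝓑 : StationaryAFBlackHole.{0}) [𝓑.metric.HasLeviCivita]
    {S : Set 𝓑.carrier} (hSd : S ⊆ 𝓑.doc) : stationaryOrbit 𝓑.killing S ⊆ 𝓑.doc := by
  rintro y ⟨σ, hσ, h0, t, rfl⟩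
  exact StationaryAFBlackHole.mem_doc_of_isMIntegralCurve hσ (hSd h0) t

/-- **KERNEL ⇐ X ∧ ZF₀ (zero-energy escape certificates from a Killing time and a pointwise escape function).**  If
every vacuum `I⁺`-regular d.o.c. carries a Killing time with spacelike level sets (`hX`, Chruściel–Costa 2008, Thm. 4.5)
and every cage of every telescope hole carries a flow-invariant `C²` function strictly convex along the zero-energy null
directions over the compact `S` (`hZF`, the registered open stub `stub_zeroEnergyNullConvexFunction` verbatim), then every
such cage carries a zero-energy escape certificate `(W, F, τ, c, C)` (conclusion: the hypothesis of
`ergoregionBombModT_of_zeroEnergyEscapeCertificate` verbatim).  Proof: `W := W_F ∩ ⟨⟨M_ext⟩⟩` (open, contains the cage by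
flow-invariance of `⟨⟨M_ext⟩⟩`), `τ :=` the Killing time; `stub_certificateCompactness` gives the uniform constants over `S`
and `stub_certificateTransport` spreads both inequalities over the cage. -/
theorem zeroEnergyEscapeCertificate_of_nullConvex (hX : ∀ (𝓑 : Literature.Geometry.Lorentzian.StationaryAFBlackHole.{0}) [𝓑.metric.HasLeviCivita], 𝓑.metric.toPseudoRiemannianMetric.IsRicciFlat → 𝓑.IsIPlusRegular → ∃ t : 𝓑.carrier → ℝ, ContMDiffOn (𝓡 4) 𝓘(ℝ, ℝ) ((⊤ : ℕ∞) : WithTop ℕ∞) t 𝓑.doc ∧ (∀ γ : ℝ → 𝓑.carrier, IsMIntegralCurve γ 𝓑.killing → γ 0 ∈ 𝓑.doc → ∀ s : ℝ, t (γ s) = t (γ 0) + s) ∧ ∀ x ∈ 𝓑.doc, ∀ k : TangentSpace (𝓡 4) x, 𝓑.metric.val x k k ≤ 0 → k ≠ 0 → mvfderiv (𝓡 4) t x k ≠ 0)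
    (hZF : ∀ (𝓑 : Literature.Geometry.Lorentzian.StationaryAFBlackHole.{0}) [𝓑.metric.HasLeviCivita] [Literature.Geometry.Lorentzian.Kerr.Facts], 𝓑.metric.toPseudoRiemannianMetric.IsRicciFlat → 𝓑.IsIPlusRegular → (∀ p : 𝓑.carrier, p ∈ 𝓑.metric.chronologicalFuture 𝓑.timeOrientation 𝓑.Mext) → (∀ p ∈ 𝓑.doc, 𝓑.killing p ≠ 0) → SimplyConnectedSpace 𝓑.doc → ∀ (U : Set 𝓑.carrier) (K : Π x : 𝓑.carrier, TangentSpace (𝓡 4) x), IsOpen U → 𝓑.horizon ⊆ U → IsConnected 𝓑.horizon → ContMDiffOn (𝓡 4) ((𝓡 4).prod 𝓘(ℝ, Literature.Geometry.Lorentzian.E4)) ((⊤ : ℕ∞) : WithTop ℕ∞) (fun x ↦ (Bundle.TotalSpace.mk' Literature.Geometry.Lorentzian.E4 x (K x) : TangentBundle (𝓡 4) 𝓑.carrier)) U → (∀ x ∈ U, ∀ v w : TangentSpace (𝓡 4) x, 𝓑.metric.val x (𝓑.metric.leviCivita K x v) w + 𝓑.metric.val x v (𝓑.metric.leviCivita K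 x w) = 0) → (∀ x ∈ U, VectorField.mlieBracket (𝓡 4) 𝓑.killing K x = 0) → (∀ p ∈ 𝓑.horizon, K p ≠ 0) → (∀ γ : ℝ → 𝓑.carrier, IsMIntegralCurve γ K → γ 0 ∈ 𝓑.horizon → ∀ t, γ t ∈ 𝓑.horizon) → (∀ x ∈ U ∩ 𝓑.doc, 𝓑.metric.val x (K x) (K x) < 0) → (∃ S₀ : Set 𝓑.carrier, IsCompact S₀ ∧ S₀ ⊆ 𝓑.doc ∧ ∀ y ∈ 𝓑.doc, 0 ≤ 𝓑.metric.val y (𝓑.killing y) (𝓑.killing y) → y ∉ U → y ∈ Literature.Geometry.Lorentzian.stationaryOrbit 𝓑.killing S₀) → ∀ S : Set 𝓑.carrier, IsCompact S → S ⊆ 𝓑.doc → ∃ (W : Set 𝓑.carrier) (F : 𝓑.carrier → ℝ), IsOpen W ∧ Literature.Geometry.Lorentzian.stationaryOrbit 𝓑.killing S ⊆ W ∧ ContMDiffOn (𝓡 4) 𝓘(ℝ, ℝ) 2 F W ∧ (∀ σ : ℝ → 𝓑.carrier, IsMIntegralCurve σ 𝓑.killing → σ 0 ∈ W → ∀ t,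 F (σ t) = F (σ 0)) ∧ ∀ x ∈ S, ∀ k : TangentSpace (𝓡 4) x, 𝓑.metric.val x k k = 0 → 𝓑.metric.val x k (𝓑.killing x) = 0 → k ≠ 0 → 0 < 𝓑.metric.toPseudoRiemannianMetric.hessian F x k k) :
    ∀ (𝓑 : Literature.Geometry.Lorentzian.StationaryAFBlackHole.{0}) [𝓑.metric.HasLeviCivita] [Literature.Geometry.Lorentzian.Kerr.Facts], 𝓑.metric.toPseudoRiemannianMetric.IsRicciFlat → 𝓑.IsIPlusRegular → (∀ p : 𝓑.carrier, p ∈ 𝓑.metric.chronologicalFuture 𝓑.timeOrientation 𝓑.Mext) → (∀ p ∈ 𝓑.doc, 𝓑.killing p ≠ 0) → SimplyConnectedSpace 𝓑.doc → ∀ (U : Set 𝓑.carrier) (K : Π x : 𝓑.carrier, TangentSpace (𝓡 4) x), IsOpen U → 𝓑.horizon ⊆ U → IsConnected 𝓑.horizon → ContMDiffOn (𝓡 4) ((𝓡 4).prod 𝓘(ℝ, Literature.Geometry.Lorentzian.E4)) ((⊤ : ℕ∞) : WithTop ℕ∞) (fun x ↦ (Bundle.TotalSpace.mk' Literature.Geometry.Lorentzian.E4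 x (K x) : TangentBundle (𝓡 4) 𝓑.carrier)) U → (∀ x ∈ U, ∀ v w : TangentSpace (𝓡 4) x, 𝓑.metric.val x (𝓑.metric.leviCivita K x v) w + 𝓑.metric.val x v (𝓑.metric.leviCivita K x w) = 0) → (∀ x ∈ U, VectorField.mlieBracket (𝓡 4) 𝓑.killing K x = 0) → (∀ p ∈ 𝓑.horizon, K p ≠ 0) → (∀ γ : ℝ → 𝓑.carrier, IsMIntegralCurve γ K → γ 0 ∈ 𝓑.horizon → ∀ t, γ t ∈ 𝓑.horizon) → (∀ x ∈ U ∩ 𝓑.doc, 𝓑.metric.val x (K x) (K x) < 0) → (∃ S₀ : Set 𝓑.carrier, IsCompact S₀ ∧ S₀ ⊆ 𝓑.doc ∧ ∀ y ∈ 𝓑.doc, 0 ≤ 𝓑.metric.val y (𝓑.killing y) (𝓑.killing y) → y ∉ U → y ∈ Literature.Geometry.Lorentzian.stationaryOrbit 𝓑.killing S₀) → ∀ S : Set 𝓑.carrier, IsCompact S → S ⊆ 𝓑.doc → ∃ (W : Set 𝓑.carrier) (F τ : 𝓑.carrier → ℝ) (c C : ℝ), IsOpen W ∧ Literature.Geometry.Lorentzian.stationaryOrbit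 𝓑.killing S ⊆ W ∧ 0 < c ∧ ContMDiffOn (𝓡 4) 𝓘(ℝ, ℝ) 2 F W ∧ ContMDiffOn (𝓡 4) 𝓘(ℝ, ℝ) 2 τ W ∧ (∀ σ : ℝ → 𝓑.carrier, IsMIntegralCurve σ 𝓑.killing → σ 0 ∈ W → ∀ t, F (σ t) = F (σ 0) ∧ τ (σ t) = τ (σ 0) + t) ∧ (∀ x ∈ W, ∀ k : TangentSpace (𝓡 4) x, 𝓑.metric.val x k k = 0 → k ≠ 0 → mvfderiv (𝓡 4) τ x k ≠ 0) ∧ ∀ x ∈ Literature.Geometry.Lorentzian.stationaryOrbit 𝓑.killing S, ∀ k : TangentSpace (𝓡 4) x, 𝓑.metric.val x k k = 0 → 𝓑.metric.val x k (𝓑.killing x) = 0 → c * (mvfderiv (𝓡 4) τ x k) ^ 2 ≤ 𝓑.metric.toPseudoRiemannianMetric.hessian F x k k ∧ |𝓑.metric.toPseudoRiemannianMetric.hessian τ x k k| ≤ C * (mvfderiv (𝓡 4) τ x k) ^ 2 := by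
  intro 𝓑 _ _ h1 h2 h3 h4 h5 U K hU hHU hc hK hKill hbr hK0 htan htl hbelt S hS hSd
  -- X: the Killing time
  obtain ⟨τ, hτ, hτeq, hτnd⟩ := hX 𝓑 h1 h2
  -- ZF₀: the invariant strictly zero-energy-null-convex function
  obtain ⟨W, F, hW, hSW, hF, hFinv, hpos⟩ :=
    hZF 𝓑 h1 h2 h3 h4 h5 U K hU hHU hc hK hKill hbr hK0 htan htl hbelt S hS hSd
  have hdoc : IsOpen 𝓑.doc :=
    𝓑.isOpen_doc LorentzianMetric.isOpen_chronologicalFuture_holds_of_boundaryless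
      LorentzianMetric.isOpen_chronologicalPast_holds_of_boundaryless
  set W' : Set 𝓑.carrier := W ∩ 𝓑.doc with hW'
  have hW'o : IsOpen W' := hW.inter hdoc
  have hSW' : stationaryOrbit 𝓑.killing S ⊆ W' :=
    subset_inter hSW (stationaryOrbit_subset_doc' 𝓑 hSd)
  have hSsub : S ⊆ W' := (subset_stationaryOrbit 𝓑.isStationaryKilling.isCompleteVectorField S).trans hSW'
  have hF' : ContMDiffOn (𝓡 4) 𝓘(ℝ, ℝ) 2 F W' := hF.mono inter_subset_left
  have hτ' : ContMDiffOn (𝓡 4) 𝓘(ℝ, ℝ) 2 τ W' :=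
    (hτ.of_le (WithTop.coe_le_coe.mpr le_top)).mono inter_subset_right
  have hinv : ∀ σ : ℝ → 𝓑.carrier, IsMIntegralCurve σ 𝓑.killing → σ 0 ∈ W' →
      ∀ t, F (σ t) = F (σ 0) ∧ τ (σ t) = τ (σ 0) + t := fun σ hσ h0 t ↦
    ⟨hFinv σ hσ h0.1 t, hτeq σ hσ h0.2 t⟩
  have hnd : ∀ x ∈ W', ∀ k : TangentSpace (𝓡 4) x, 𝓑.metric.val x k k = 0 → k ≠ 0 →
      mvfderiv (𝓡 4) τ x k ≠ 0 := fun x hx k hk hk0 ↦ hτnd x hx.2 k hk.le hk0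
  -- U2: uniform constants over `S`
  obtain ⟨c, C, hc0, hSbd⟩ := stub_certificateCompactness 𝓑 S W' F τ hS hW'o hSsub hF' hτ' hnd hpos
  -- U1: transport over the cage
  have htr := stub_certificateTransport 𝓑 S W' F τ hW'o hSW' hF' hτ' hinv
  refine ⟨W', F, τ, c, C, hW'o, hSW', hc0, hF', hτ', hinv, hnd, fun x hx k hk hkT ↦ ?_⟩
  obtain ⟨s, hs, L, hL, hLv⟩ := htr x hx
  obtain ⟨v, rfl⟩ := hL.2 k
  obtain ⟨hg, hgT, hdτ, hHF, hHτ⟩ := hLv v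
  rw [hg] at hk
  rw [hgT] at hkT
  rw [hdτ, hHF, hHτ]
  exact hSbd s hs v hk hkT

/-- **`ErgoregionBombModT ⇐ X ∧ ZF₀`.**  Under the named fact X (Chruściel–Costa 2008, Thm. 4.5 with spacelike level
sets) and the pointwise zero-energy escape function ZF₀ on every cage of every telescope hole, the crux
`Theses.ZeroEnergyKerrOrBomb.ErgoregionBombModT` holds — the conclusion below is its body verbatim; by vacuity of its
antecedent (`ergoregionBombModT_of_zeroEnergyEscapeCertificate` on the assembled kernel).  Conditional on X and ZF₀. -/
theorem ergoregionBombModT_of_nullConvex (hX : ∀ (𝓑 : Literature.Geometry.Lorentzian.StationaryAFBlackHole.{0}) [𝓑.metric.HasLeviCivita], 𝓑.metric.toPseudoRiemannianMetric.IsRicciFlat → 𝓑.IsIPlusRegular → ∃ t : 𝓑.carrier → ℝ, ContMDiffOn (𝓡 4) 𝓘(ℝ, ℝ) ((⊤ : ℕ∞) : WithTop ℕ∞) t 𝓑.doc ∧ (∀ γ : ℝ → 𝓑.carrier, IsMIntegralCurve γ 𝓑.killing → γ 0 ∈ 𝓑.doc → ∀ s : ℝ, t (γ s) = t (γ 0)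 + s) ∧ ∀ x ∈ 𝓑.doc, ∀ k : TangentSpace (𝓡 4) x, 𝓑.metric.val x k k ≤ 0 → k ≠ 0 → mvfderiv (𝓡 4) t x k ≠ 0)
    (hZF : ∀ (𝓑 : Literature.Geometry.Lorentzian.StationaryAFBlackHole.{0}) [𝓑.metric.HasLeviCivita] [Literature.Geometry.Lorentzian.Kerr.Facts], 𝓑.metric.toPseudoRiemannianMetric.IsRicciFlat → 𝓑.IsIPlusRegular → (∀ p : 𝓑.carrier, p ∈ 𝓑.metric.chronologicalFuture 𝓑.timeOrientation 𝓑.Mext) → (∀ p ∈ 𝓑.doc, 𝓑.killing p ≠ 0) → SimplyConnectedSpace 𝓑.doc → ∀ (U : Set 𝓑.carrier) (K : Π x : 𝓑.carrier, TangentSpace (𝓡 4) x), IsOpen U → 𝓑.horizon ⊆ U → IsConnected 𝓑.horizon → ContMDiffOn (𝓡 4) ((𝓡 4).prod 𝓘(ℝ, Literature.Geometry.Lorentzian.E4)) ((⊤ : ℕ∞) : WithTop ℕ∞) (fun x ↦ (Bundle.TotalSpace.mk' Literature.Geometry.Lorentzian.E4 x (K x) : TangentBundle (𝓡 4) 𝓑.carrier))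 U → (∀ x ∈ U, ∀ v w : TangentSpace (𝓡 4) x, 𝓑.metric.val x (𝓑.metric.leviCivita K x v) w + 𝓑.metric.val x v (𝓑.metric.leviCivita K x w) = 0) → (∀ x ∈ U, VectorField.mlieBracket (𝓡 4) 𝓑.killing K x = 0) → (∀ p ∈ 𝓑.horizon, K p ≠ 0) → (∀ γ : ℝ → 𝓑.carrier, IsMIntegralCurve γ K → γ 0 ∈ 𝓑.horizon → ∀ t, γ t ∈ 𝓑.horizon) → (∀ x ∈ U ∩ 𝓑.doc, 𝓑.metric.val x (K x) (K x) < 0) → (∃ S₀ : Set 𝓑.carrier, IsCompact S₀ ∧ S₀ ⊆ 𝓑.doc ∧ ∀ y ∈ 𝓑.doc, 0 ≤ 𝓑.metric.val y (𝓑.killing y) (𝓑.killing y) → y ∉ U → y ∈ Literature.Geometry.Lorentzian.stationaryOrbit 𝓑.killing S₀) → ∀ S : Set 𝓑.carrier, IsCompact S → S ⊆ 𝓑.doc → ∃ (W : Set 𝓑.carrier) (F : 𝓑.carrier → ℝ), IsOpen W ∧ Literature.Geometry.Lorentzian.stationaryOrbit 𝓑.killing S ⊆ W ∧ ContMDiffOn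 (𝓡 4) 𝓘(ℝ, ℝ) 2 F W ∧ (∀ σ : ℝ → 𝓑.carrier, IsMIntegralCurve σ 𝓑.killing → σ 0 ∈ W → ∀ t, F (σ t) = F (σ 0)) ∧ ∀ x ∈ S, ∀ k : TangentSpace (𝓡 4) x, 𝓑.metric.val x k k = 0 → 𝓑.metric.val x k (𝓑.killing x) = 0 → k ≠ 0 → 0 < 𝓑.metric.toPseudoRiemannianMetric.hessian F x k k) :
    ∀ (𝓑 : Literature.Geometry.Lorentzian.StationaryAFBlackHole.{0}) [𝓑.metric.HasLeviCivita] [Literature.Geometry.Lorentzian.Kerr.Facts], 𝓑.metric.toPseudoRiemannianMetric.IsRicciFlat → 𝓑.IsIPlusRegular → (∀ p : 𝓑.carrier, p ∈ 𝓑.metric.chronologicalFuture 𝓑.timeOrientation 𝓑.Mext) → (∀ p ∈ 𝓑.doc, 𝓑.killing p ≠ 0) → SimplyConnectedSpace 𝓑.doc → ∀ (U : Set 𝓑.carrier) (K : Π x : 𝓑.carrier, TangentSpace (𝓡 4) x), IsOpen U → 𝓑.horizon ⊆ U → IsConnected 𝓑.horizon → ContMDiffOn (𝓡 4) ((𝓡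 4).prod 𝓘(ℝ, Literature.Geometry.Lorentzian.E4)) ((⊤ : ℕ∞) : WithTop ℕ∞) (fun x ↦ (Bundle.TotalSpace.mk' Literature.Geometry.Lorentzian.E4 x (K x) : TangentBundle (𝓡 4) 𝓑.carrier)) U → (∀ x ∈ U, ∀ v w : TangentSpace (𝓡 4) x, 𝓑.metric.val x (𝓑.metric.leviCivita K x v) w + 𝓑.metric.val x v (𝓑.metric.leviCivita K x w) = 0) → (∀ x ∈ U, VectorField.mlieBracket (𝓡 4) 𝓑.killing K x = 0) → (∀ p ∈ 𝓑.horizon, K p ≠ 0) → (∀ γ : ℝ → 𝓑.carrier, IsMIntegralCurve γ K → γ 0 ∈ 𝓑.horizon → ∀ t, γ t ∈ 𝓑.horizon) → (∀ x ∈ U ∩ 𝓑.doc, 𝓑.metric.val x (K x) (K x) < 0) → (∃ S₀ : Set 𝓑.carrier, IsCompact S₀ ∧ S₀ ⊆ 𝓑.doc ∧ ∀ y ∈ 𝓑.doc, 0 ≤ 𝓑.metric.val y (𝓑.killing y) (𝓑.killing y) → y ∉ U → y ∈ Literature.Geometry.Lorentzian.stationaryOrbit 𝓑.killing S₀) → ∀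 S : Set 𝓑.carrier, IsCompact S → S ⊆ 𝓑.doc → ∀ (γ : ℝ → 𝓑.carrier) (s : Set ℝ), Literature.Geometry.Lorentzian.IsMaximalGeodesicOn 𝓑.metric.toPseudoRiemannianMetric.leviCivita γ s → s.Nonempty → (∀ t ∈ s, 𝓑.metric.val (γ t) (Literature.Geometry.Lorentzian.velocity (𝓡 4) γ t) (Literature.Geometry.Lorentzian.velocity (𝓡 4) γ t) = 0 ∧ Literature.Geometry.Lorentzian.velocity (𝓡 4) γ t ≠ 0 ∧ 𝓑.metric.val (γ t) (Literature.Geometry.Lorentzian.velocity (𝓡 4) γ t) (𝓑.killing (γ t)) = 0) → (∀ t ∈ s, γ t ∈ Literature.Geometry.Lorentzian.stationaryOrbit 𝓑.killing S) → ∃ (ν ω : ℝ) (ψ χ : 𝓑.carrier → ℝ), 0 < ν ∧ (∃ U : Set 𝓑.carrier, IsOpen U ∧ 𝓑.doc ∪ 𝓑.horizon ⊆ U ∧ ContMDiffOn (𝓡 4) 𝓘(ℝ, ℝ) ((⊤ : ℕ∞) : WithTop ℕ∞) ψ U ∧ ContMDiffOn (𝓡 4) 𝓘(ℝ, ℝ)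 ((⊤ : ℕ∞) : WithTop ℕ∞) χ U) ∧ (∀ x ∈ 𝓑.doc, 𝓑.metric.dalembertian ψ x = 0 ∧ 𝓑.metric.dalembertian χ x = 0) ∧ (∀ x ∈ 𝓑.doc, mfderiv (𝓡 4) 𝓘(ℝ, ℝ) ψ x (𝓑.killing x) = ν * ψ x - ω * χ x ∧ mfderiv (𝓡 4) 𝓘(ℝ, ℝ) χ x (𝓑.killing x) = ω * ψ x + ν * χ x) ∧ (∃ C : ℝ, ∀ x ∈ 𝓑.doc ∩ 𝓑.metric.chronologicalPast 𝓑.timeOrientation (𝓑.embed '' 𝓑.e.far (𝓑.e.R + 1)), |ψ x| ≤ C ∧ |χ x| ≤ C) ∧ ∃ x ∈ 𝓑.doc, ψ x ≠ 0 ∨ χ x ≠ 0 :=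
  ergoregionBombModT_of_zeroEnergyEscapeCertificate (zeroEnergyEscapeCertificate_of_nullConvex hX hZF)

/-! ### The pointwise escape function alone excludes Killing light points -/

/-- **`NoDocLightPoints ⇐ ZF₀`** (no Killing time needed).  If every cage of every telescope hole carries a
flow-invariant `C²` function strictly convex along the zero-energy null directions (`hZF`, the open stub verbatim), then
no telescope hole has a Killing light point in its d.o.c. (conclusion: hypothesis `hNo` of
`ergoregionBombModT_of_offWall_of_noDocLightPoints`, p135563, verbatim): at `p ∈ ⟨⟨M_ext⟩⟩` with `g(T, T)(p) = 0` and
`∇_T T (p) = κ T(p)`, take `S = {p}`; `T(p) ≠ 0` is a zero-energy null vector, so `Hess F(T, T)(p) > 0`, whereas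
`dF(T) = 0` near `p` (`mfderiv_killing_eq_zero_of_flowInvariant`) gives `Hess F(T, T)(p) = 0` at a light point
(`hessian_killing_killing_eq_zero_of_lightPoint`). -/
theorem noDocLightPoints_of_nullConvex
    (hZF : ∀ (𝓑 : Literature.Geometry.Lorentzian.StationaryAFBlackHole.{0}) [𝓑.metric.HasLeviCivita] [Literature.Geometry.Lorentzian.Kerr.Facts], 𝓑.metric.toPseudoRiemannianMetric.IsRicciFlat → 𝓑.IsIPlusRegular → (∀ p : 𝓑.carrier, p ∈ 𝓑.metric.chronologicalFuture 𝓑.timeOrientation 𝓑.Mext) → (∀ p ∈ 𝓑.doc, 𝓑.killing p ≠ 0) → SimplyConnectedSpace 𝓑.doc → ∀ (U : Set 𝓑.carrier) (K : Π x : 𝓑.carrier, TangentSpace (𝓡 4) x), IsOpen U → 𝓑.horizon ⊆ U → IsConnected 𝓑.horizon → ContMDiffOn (𝓡 4) ((𝓡 4).prod 𝓘(ℝ, Literature.Geometry.Lorentzian.E4)) ((⊤ : ℕ∞) : WithTop ℕ∞) (fun x ↦ (Bundle.TotalSpace.mk' Literature.Geometry.Lorentzian.E4 x (K x) : TangentBundle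 (𝓡 4) 𝓑.carrier)) U → (∀ x ∈ U, ∀ v w : TangentSpace (𝓡 4) x, 𝓑.metric.val x (𝓑.metric.leviCivita K x v) w + 𝓑.metric.val x v (𝓑.metric.leviCivita K x w) = 0) → (∀ x ∈ U, VectorField.mlieBracket (𝓡 4) 𝓑.killing K x = 0) → (∀ p ∈ 𝓑.horizon, K p ≠ 0) → (∀ γ : ℝ → 𝓑.carrier, IsMIntegralCurve γ K → γ 0 ∈ 𝓑.horizon → ∀ t, γ t ∈ 𝓑.horizon) → (∀ x ∈ U ∩ 𝓑.doc, 𝓑.metric.val x (K x) (K x) < 0) → (∃ S₀ : Set 𝓑.carrier, IsCompact S₀ ∧ S₀ ⊆ 𝓑.doc ∧ ∀ y ∈ 𝓑.doc, 0 ≤ 𝓑.metric.val y (𝓑.killing y) (𝓑.killing y) → y ∉ U → y ∈ Literature.Geometry.Lorentzian.stationaryOrbit 𝓑.killing S₀) → ∀ S : Set 𝓑.carrier, IsCompact S → S ⊆ 𝓑.doc → ∃ (W : Set 𝓑.carrier) (F : 𝓑.carrier → ℝ), IsOpen W ∧ Literature.Geometry.Lorentzian.stationaryOrbit 𝓑.killing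 S ⊆ W ∧ ContMDiffOn (𝓡 4) 𝓘(ℝ, ℝ) 2 F W ∧ (∀ σ : ℝ → 𝓑.carrier, IsMIntegralCurve σ 𝓑.killing → σ 0 ∈ W → ∀ t, F (σ t) = F (σ 0)) ∧ ∀ x ∈ S, ∀ k : TangentSpace (𝓡 4) x, 𝓑.metric.val x k k = 0 → 𝓑.metric.val x k (𝓑.killing x) = 0 → k ≠ 0 → 0 < 𝓑.metric.toPseudoRiemannianMetric.hessian F x k k) :
    ∀ (𝓑 : Literature.Geometry.Lorentzian.StationaryAFBlackHole.{0}) [𝓑.metric.HasLeviCivita] [Literature.Geometry.Lorentzian.Kerr.Facts], 𝓑.metric.toPseudoRiemannianMetric.IsRicciFlat → 𝓑.IsIPlusRegular → (∀ p : 𝓑.carrier, p ∈ 𝓑.metric.chronologicalFuture 𝓑.timeOrientation 𝓑.Mext) → (∀ p ∈ 𝓑.doc, 𝓑.killing p ≠ 0) → SimplyConnectedSpace 𝓑.doc → ∀ (U : Set 𝓑.carrier) (K : Π x : 𝓑.carrier, TangentSpace (𝓡 4) x), IsOpen U → 𝓑.horizon ⊆ U → IsConnected 𝓑.horizon → ContMDiffOn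 (𝓡 4) ((𝓡 4).prod 𝓘(ℝ, Literature.Geometry.Lorentzian.E4)) ((⊤ : ℕ∞) : WithTop ℕ∞) (fun x ↦ (Bundle.TotalSpace.mk' Literature.Geometry.Lorentzian.E4 x (K x) : TangentBundle (𝓡 4) 𝓑.carrier)) U → (∀ x ∈ U, ∀ v w : TangentSpace (𝓡 4) x, 𝓑.metric.val x (𝓑.metric.leviCivita K x v) w + 𝓑.metric.val x v (𝓑.metric.leviCivita K x w) = 0) → (∀ x ∈ U, VectorField.mlieBracket (𝓡 4) 𝓑.killing K x = 0) → (∀ p ∈ 𝓑.horizon, K p ≠ 0) → (∀ γ : ℝ → 𝓑.carrier, IsMIntegralCurve γ K → γ 0 ∈ 𝓑.horizon → ∀ t, γ t ∈ 𝓑.horizon) → (∀ x ∈ U ∩ 𝓑.doc, 𝓑.metric.val x (K x) (K x) < 0) → (∃ S₀ : Set 𝓑.carrier, IsCompact S₀ ∧ S₀ ⊆ 𝓑.doc ∧ ∀ y ∈ 𝓑.doc, 0 ≤ 𝓑.metric.val y (𝓑.killing y) (𝓑.killing y) → y ∉ U → y ∈ Literature.Geometry.Lorentzian.stationaryOrbit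 𝓑.killing S₀) → ∀ p ∈ 𝓑.doc, 𝓑.metric.val p (𝓑.killing p) (𝓑.killing p) = 0 → ∀ κ : ℝ, 𝓑.metric.leviCivita 𝓑.killing p (𝓑.killing p) ≠ κ • 𝓑.killing p := by
  intro 𝓑 _ _ h1 h2 h3 h4 h5 U K hU hHU hc hK hKill hbr hK0 htan htl hbelt p hp hlam κ hacc
  obtain ⟨W, F, hW, hSW, hF, hFinv, hpos⟩ :=
    hZF 𝓑 h1 h2 h3 h4 h5 U K hU hHU hc hK hKill hbr hK0 htan htl hbelt {p} isCompact_singleton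
      (singleton_subset_iff.2 hp)
  have hpW : p ∈ W :=
    hSW (subset_stationaryOrbit 𝓑.isStationaryKilling.isCompleteVectorField _ (mem_singleton p))
  have hF1 : ContMDiffOn (𝓡 4) 𝓘(ℝ, ℝ) 1 F W := hF.of_le (by norm_num)
  -- `dF(T) = 0` near `p`
  have hF0 : ∀ᶠ x in 𝓝 p, mfderiv (𝓡 4) 𝓘(ℝ, ℝ) F x (𝓑.killing x) = 0 := by
    filter_upwards [hW.mem_nhds hpW] with x hx
    exact mfderiv_killing_eq_zero_of_flowInvariant 𝓑 hW hF1 hFinv hx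
  -- at a light point the Hessian of the invariant `F` vanishes on `(T, T)` …
  have hHess0 : 𝓑.metric.toPseudoRiemannianMetric.hessian F p (𝓑.killing p) (𝓑.killing p) = 0 :=
    hessian_killing_killing_eq_zero_of_lightPoint 𝓑 F p κ (hF.contMDiffAt (hW.mem_nhds hpW)) hF0 hacc
  -- … but `T(p)` is a non-zero zero-energy null vector, on which `Hess F > 0`
  have h := hpos p (mem_singleton p) (𝓑.killing p) hlam hlam (h4 p hp)
  rw [hHess0] at h
  exact lt_irrefl 0 h

end Summit.FinalStateConjecture.FinalStateConjecture.Theorems.ErgoregionBombModT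

end
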